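import Literature.Geometry.Riemannian.TwoPositiveCurvatureOperator
import Literature.Geometry.Riemannian.RoundSphere
import Literature.Geometry.Lorentzian.MinkowskiFlat
import HarnessLib

/-!
# Two-positive curvature operator and PIC1: the definitions have no `_holds` (Euclidean space is a counterexample)
(topic `Geometry/Riemannian`)

Companion of `Literature/Geometry/Riemannian/TwoPositiveCurvatureOperator.lean`. That file vendors
**Böhm–Wilking 2008, p. 1079** ("Recall that a curvature operator is called 2-positive, if the sum of
its two smallest eigenvalues is positive") as the *definitions*
`PseudoRiemannianMetric.HasTwoPositiveCurvatureOperatorWith g cov` and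
`PseudoRiemannianMetric.HasTwoPositiveCurvatureOperator g` — predicates on a metric (the hypothesis
of Böhm–Wilking's Thm. 1), with the explicit binder `g`, not assertions. The facts census
nevertheless listed `HasTwoPositiveCurvatureOperator` (a `def … : Prop`) as an undischarged named
fact. This file records, in closed machine-checked form, why no
`HasTwoPositiveCurvatureOperator_holds` can exist: the only closed reading of the definition, its
universal closure "every metric has 2-positive curvature operator", is **false** — Euclidean space
`ℝ³` (indeed every finite-dimensional real inner product space of dimension `≥ 3` with its Euclidean
metric) is flat, and a flat metric carrying an orthonormal 3-frame is not 2-positive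
(`not_hasTwoPositiveCurvatureOperator_of_isFlat` of the definition file, whose three hypotheses are
instantiated here).

## Contents (all proved; no definition, no named fact)

* `isOrthonormalFrame_euclideanMetric` — an orthonormal family of vectors of an inner product space
  `V` is a `g`-orthonormal frame for the Euclidean metric `g = euclideanMetric V` (`RoundSphere.lean`)
  at every point.
* `not_hasTwoPositiveCurvatureOperatorWith_euclideanMetric_flatConnection`,
  **`not_hasTwoPositiveCurvatureOperator_euclideanMetric`** — for `3 ≤ dim V < ∞` the Euclidean metric
  of `V` does not have 2-positive curvature operator: its natural connection `D`
  (`ModelSpace.flatConnection`, O'Neill 1983, Ch. 3, Def. 3.8) is a Levi-Civita connection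
  (`ModelSpace.isLeviCivita_flatConnection`, O'Neill Lemma 3.14) and is flat
  (`ModelSpace.isFlat_flatConnection`, O'Neill p. 80: "every semi-Euclidean space is flat"), and the
  first three vectors of the standard orthonormal basis are an orthonormal 3-frame.
* **`not_forall_hasTwoPositiveCurvatureOperator`** — the universal closure of the definition, in the
  exact shape a `HasTwoPositiveCurvatureOperator_holds` would have on the manifold `ℝ³`
  (`EuclideanSpace ℝ (Fin 3)` modelled on itself), is false.

Böhm–Wilking themselves work with the condition only as a hypothesis ("On a compact manifold the
normalized Ricci flow evolves a Riemannian metric with 2-positive curvature operator to a limit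
metric with constant sectional curvature", Thm. 1, p. 1079); flat tori are the standard compact
metrics violating it (Hamilton 1986, p. 154, quoted in `CurvatureOperator.lean`).

## PIC1 and the sibling conditions (appended)

The same file (`TwoPositiveCurvatureOperator.lean`) also vendors **Brendle 2008, Thm. 2,
condition (2)** — "`R₁₃₁₃ + λ²R₁₄₁₄ + R₂₃₂₃ + λ²R₂₄₂₄ - 2λR₁₂₃₄ > 0` for all orthonormal four-frames
`{e₁, e₂, e₃, e₄}` and all `λ ∈ [-1, 1]`" (PIC1) — as the definitions `HasPIC1With g cov` /
`HasPIC1 g`, and the census likewise listed `HasPIC1` as an undischarged fact. It is not one: in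
Brendle's paper (§1, p. 2) condition (2) is the *assumption* of Thm. 2 ("Let `(M, g₀)` be a compact
Riemannian manifold of dimension `n ≥ 4`. Assume that (2) holds for all orthonormal four-frames and
all `λ ∈ [-1, 1]`. Then the normalized Ricci flow with initial metric `g₀` exists for all time and
converges to a constant curvature metric"), whose conclusion is a statement about the Ricci flow
(not vendored in this tree), and the assumption fails for flat metrics. The appended part records
this in closed form, reusing the plumbing above:

* `PseudoRiemannianMetric.not_hasPIC1_of_isFlat`,
  `PseudoRiemannianMetric.not_hasPositiveCurvatureOperator_of_isFlat` — the metric-level forms (any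
  manifold) of `not_hasPIC1With_of_isFlat` (`TwoPositiveCurvatureOperator.lean`) and
  `not_hasPositiveCurvatureOperatorWith_of_isFlat` (`CurvatureOperator.lean`): a metric with a flat
  Levi-Civita connection and an orthonormal 4-frame (resp. an orthonormal pair) at some point is
  not PIC1 (resp. does not have positive curvature operator).
* `orthonormal_stdOrthonormalBasis_comp_castLE` (an orthonormal `k`-family exists when
  `k ≤ dim V`), `isLeviCivita_flatConnection_euclideanMetric` (O'Neill 1983, Lemma 3.14 for the
  Euclidean metric).
* `not_hasPIC1With_euclideanMetric_flatConnection`, **`not_hasPIC1_euclideanMetric`**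
  (`4 ≤ dim V < ∞`), **`not_hasPIC1_euclideanSpace_four`** (`ℝ⁴`), **`not_forall_hasPIC1`** (the
  universal closure in the shape a `HasPIC1_holds` would have on `ℝ⁴` is false).
* For the two sibling conditions of `CurvatureOperator.lean` / `IsotropicCurvature.lean`, through
  which the chain PCO ⇒ 2-PCO ⇒ PIC1 ⇒ PIC of the definition files runs:
  `not_hasPositiveIsotropicCurvature_euclideanMetric` (`4 ≤ dim V`),
  `not_hasPositiveCurvatureOperator_euclideanMetric` (`2 ≤ dim V`), and
  `not_hasPositiveIsotropicCurvature_euclideanSpace_four`,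
  `not_hasPositiveCurvatureOperator_euclideanSpace_four`.

Brendle: "The curvature conditions (1) and (2) are void in dimension less than 4" — accordingly the
counterexamples need `dim V ≥ 4` (an orthonormal 4-frame), and `ℝ⁴` is the smallest Euclidean one.

## References

* S. Brendle, *A general convergence result for the Ricci flow in higher dimensions*, Duke Math.
  J. 145 (2008) 585–601 (arXiv:0706.1218): §1, Thm. 2 and condition (2), p. 2. [Brendle2008]
* C. Böhm, B. Wilking, *Manifolds with positive curvature operators are space forms*, Ann. of
  Math. (2) 167 (2008) 1079–1097 (arXiv:math/0606187): Introduction, p. 1079 (definition of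
  2-positive before Thm. 1; Thm. 1). [BohmWilking2008]
* B. O'Neill, *Semi-Riemannian geometry with applications to relativity*, Academic Press 1983,
  Ch. 3: Def. 3.8, Lemma 3.14 (p. 65), remark after Prop. 3.41 (p. 80). [ONeillSemiRiemannian1983]
* R. S. Hamilton, *Four-manifolds with positive curvature operator*, J. Differential Geom. 24
  (1986), p. 154 (flat tori). [Hamilton1986]
-/

noncomputable section

open Bundle Module
open scoped Manifold ContDiff Topology RealInnerProductSpace

namespace Literature.Geometry.Riemannian

open Lorentzian Lorentzian.PseudoRiemannianMetric

section Euclidean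

variable {V : Type*} [NormedAddCommGroup V] [InnerProductSpace ℝ V]

/-- An orthonormal family `e : ι → V` of a real inner product space is, at every point `x`, a
`g_x`-orthonormal frame for the Euclidean metric `g = euclideanMetric V` (`g_x = ⟪·, ·⟫`,
`euclideanMetric_apply`). [folklore] -/
theorem isOrthonormalFrame_euclideanMetric {ι : Type*} {e : ι → V} (he : Orthonormal ℝ e) (x : V) :
    (euclideanMetric V).IsOrthonormalFrame (ι := ι) x e := by
  classical
  rw [orthonormal_iff_ite] at he
  -- `g_x(eᵢ, eⱼ)` is `⟪eᵢ, eⱼ⟫` by `rfl` (`euclideanMetric_apply`; stated with `change` so that the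
  -- inner product is the one of `V`, not the induced one on `T_x V`)
  refine ⟨fun i ↦ ?_, fun i j hij ↦ ?_⟩
  · change ⟪e i, e i⟫ = 1
    rw [he i i, if_pos rfl]
  · change ⟪e i, e j⟫ = 0
    rw [he i j, if_neg hij]

/-- The Euclidean metric of `V` has constant components: `g_y = ⟪·, ·⟫` (Mathlib's `innerSL`) for
every `y`, so O'Neill's Lemma 3.14 (`ModelSpace.isLeviCivita_flatConnection`) applies to it.
[cite: ONeillSemiRiemannian1983, Ch. 3, Lemma 3.14] -/
theorem euclideanMetric_val_eq_innerSL (y : V) :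
    (euclideanMetric V).val y = (innerSL ℝ (E := V) : V →L[ℝ] V →L[ℝ] ℝ) :=
  rfl

variable [FiniteDimensional ℝ V]

/-- **Euclidean space is not 2-positive** (pair form): for the Euclidean metric of a
finite-dimensional real inner product space `V` of dimension `≥ 3` and its natural (flat,
Levi-Civita) connection `D` (`ModelSpace.flatConnection V`; O'Neill 1983, Ch. 3, Def. 3.8,
Lemma 3.14, p. 80), the pair `(g, D)` does not have 2-positive curvature operator: `Rm ≡ 0`, while
the first three standard orthonormal basis vectors give an orthonormal pair of 2-vectors
`e₀ ∧ e₁, e₀ ∧ e₂` on which `Rm(φ₁,φ₁) + Rm(φ₂,φ₂) = 0 ≯ 0`.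
[cite: ONeillSemiRiemannian1983, Ch. 3, remark after Prop. 3.41 (p. 80)] -/
theorem not_hasTwoPositiveCurvatureOperatorWith_euclideanMetric_flatConnection
    (hV : 3 ≤ finrank ℝ V) :
    ¬ (euclideanMetric V).HasTwoPositiveCurvatureOperatorWith (ModelSpace.flatConnection V) :=
  not_hasTwoPositiveCurvatureOperatorWith_of_isFlat_of_isOrthonormalFrame
    ModelSpace.isFlat_flatConnection
    (isOrthonormalFrame_euclideanMetric
      ((stdOrthonormalBasis ℝ V).orthonormal.comp (Fin.castLE hV) (Fin.castLE_injective hV)) 0)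

variable [CompleteSpace V]

/-- **Euclidean space is not 2-positive**: for a finite-dimensional real inner product space `V`
of dimension `≥ 3`, the Euclidean metric `euclideanMetric V` (as a metric on the manifold `V`
modelled on itself) does **not** have 2-positive curvature operator in the sense of Böhm–Wilking
2008, p. 1079 (`HasTwoPositiveCurvatureOperator`): its natural connection is a flat Levi-Civita
connection (O'Neill 1983, Ch. 3, Lemma 3.14 and p. 80: "every semi-Euclidean space `ℝⁿ_ν` is
flat"), so the sum of the two smallest eigenvalues of its curvature operator is `0`, not `> 0`.
Hence the definition `HasTwoPositiveCurvatureOperator` — the *hypothesis* of Böhm–Wilking's Thm. 1 —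
admits no `_holds` companion. [cite: BohmWilking2008, Introduction, p. 1079 (definition before Thm. 1)]
[cite: ONeillSemiRiemannian1983, Ch. 3, Lemma 3.14 and remark after Prop. 3.41 (p. 80)] -/
theorem not_hasTwoPositiveCurvatureOperator_euclideanMetric (hV : 3 ≤ finrank ℝ V) :
    ¬ (euclideanMetric V).HasTwoPositiveCurvatureOperator :=
  not_hasTwoPositiveCurvatureOperator_of_isFlat
    (ModelSpace.isLeviCivita_flatConnection (euclideanMetric V) (innerSL ℝ (E := V))
      euclideanMetric_val_eq_innerSL)
    ModelSpace.isFlat_flatConnection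
    (isOrthonormalFrame_euclideanMetric
      ((stdOrthonormalBasis ℝ V).orthonormal.comp (Fin.castLE hV) (Fin.castLE_injective hV)) 0)

end Euclidean

/-- **Euclidean `ℝ³` is not 2-positive**: the Euclidean metric of `EuclideanSpace ℝ (Fin 3)` does not
have 2-positive curvature operator. [cite: BohmWilking2008, Introduction, p. 1079 (definition before Thm. 1)]
[cite: ONeillSemiRiemannian1983, Ch. 3, remark after Prop. 3.41 (p. 80)] -/
theorem not_hasTwoPositiveCurvatureOperator_euclideanSpace_three :
    ¬ (euclideanMetric (EuclideanSpace ℝ (Fin 3))).HasTwoPositiveCurvatureOperator :=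
  not_hasTwoPositiveCurvatureOperator_euclideanMetric (by rw [finrank_euclideanSpace_fin])

/-- **The definition `HasTwoPositiveCurvatureOperator` is not a theorem**: its universal closure over
the metrics of one fixed manifold — smooth pseudo-Riemannian metrics on `ℝ³ = EuclideanSpace ℝ (Fin 3)`
modelled on itself, the shape a `HasTwoPositiveCurvatureOperator_holds` would take there — is false,
the Euclidean metric being a counterexample (`not_hasTwoPositiveCurvatureOperator_euclideanSpace_three`).
"2-positive curvature operator" (Böhm–Wilking 2008, p. 1079) is a curvature *condition*, the
hypothesis of their Thm. 1, not an assertion about all metrics.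
[cite: BohmWilking2008, Introduction, p. 1079 (definition before Thm. 1)] -/
theorem not_forall_hasTwoPositiveCurvatureOperator :
    ¬ ∀ g : PseudoRiemannianMetric 𝓘(ℝ, EuclideanSpace ℝ (Fin 3)) ∞ (EuclideanSpace ℝ (Fin 3))
        (TangentSpace 𝓘(ℝ, EuclideanSpace ℝ (Fin 3)) : EuclideanSpace ℝ (Fin 3) → Type _),
      g.HasTwoPositiveCurvatureOperator :=
  fun h ↦ not_hasTwoPositiveCurvatureOperator_euclideanSpace_three (h _)

/-! ### PIC1 and positive curvature operator: metric-level flat counterexamples on any manifold -/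

section General

variable {E : Type*} [NormedAddCommGroup E] [NormedSpace ℝ E] {H : Type*} [TopologicalSpace H]
  {I : ModelWithCorners ℝ E H} {M : Type*} [TopologicalSpace M] [ChartedSpace H M]
  [IsManifold I ∞ M] {n : ℕ∞ω} [FiniteDimensional ℝ E] [CompleteSpace E]
  {g : PseudoRiemannianMetric I n E (TangentSpace I : M → Type _)}
  {cov : CovariantDerivative I E (TangentSpace I : M → Type _)}

/-- **A metric with a flat Levi-Civita connection is not PIC1** (given a `g`-orthonormal 4-frame at
some point, on which Brendle's expression vanishes for every `λ`, `isotropicCurvatureOne_eq_zero_of_isFlat`):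
the metric-level form of `not_hasPIC1With_of_isFlat`. Hence the definition `HasPIC1` — Brendle's
condition (2), the hypothesis of Brendle 2008, Thm. 2 — has no `_holds` companion (flat `ℝⁿ`, `Tⁿ`,
`n ≥ 4`). [folklore] -/
theorem _root_.Literature.Geometry.Lorentzian.PseudoRiemannianMetric.not_hasPIC1_of_isFlat
    (hcov : g.IsLeviCivita cov) (h : cov.IsFlat) {x : M} {e : Fin 4 → TangentSpace I x}
    (he : g.IsOrthonormalFrame x e) : ¬ g.HasPIC1 := fun hpos ↦
  not_hasPIC1With_of_isFlat h he (hpos cov hcov)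

/-- **A metric with a flat Levi-Civita connection does not have positive curvature operator**
(given a `g`-orthonormal pair `e₀, e₁` at some point: the 2-vector `e₀ ∧ e₁` is nonzero,
`(e₀ ∧ e₁)♭(e₀, e₁) = 1`, while `Rm(φ, φ) = 0` for every `φ`): the metric-level form of
`not_hasPositiveCurvatureOperatorWith_of_isFlat` (`CurvatureOperator.lean`; Hamilton 1986, p. 154:
the flat four-manifolds `T⁴ = R⁴/Γ`). Hence `HasPositiveCurvatureOperator` has no `_holds`
companion either. [folklore] -/
theorem _root_.Literature.Geometry.Lorentzian.PseudoRiemannianMetric.not_hasPositiveCurvatureOperator_of_isFlat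
    (hcov : g.IsLeviCivita cov) (h : cov.IsFlat) {x : M} {e : Fin 2 → TangentSpace I x}
    (he : g.IsOrthonormalFrame x e) : ¬ g.HasPositiveCurvatureOperator := fun hpos ↦
  not_hasPositiveCurvatureOperatorWith_of_isFlat h (X := fun _ : Fin 1 ↦ e 0) (Y := fun _ ↦ e 1)
    ⟨e 0, e 1, by simp [he.1 0, he.1 1, he.2 1 0 (by decide)]⟩ (hpos cov hcov)

end General

/-! ### PIC1: Euclidean space is a counterexample -/

section EuclideanPIC1

variable {V : Type*} [NormedAddCommGroup V] [InnerProductSpace ℝ V] [FiniteDimensional ℝ V]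

/-- An inner product space of dimension `≥ k` carries an orthonormal family indexed by `Fin k`: the
first `k` vectors of Mathlib's `stdOrthonormalBasis` (reindexed along `Fin.castLE`). [folklore] -/
theorem orthonormal_stdOrthonormalBasis_comp_castLE {k : ℕ} (hk : k ≤ finrank ℝ V) :
    Orthonormal ℝ ((stdOrthonormalBasis ℝ V : Fin (finrank ℝ V) → V) ∘ Fin.castLE hk) :=
  (stdOrthonormalBasis ℝ V).orthonormal.comp (Fin.castLE hk) (Fin.castLE_injective hk)

/-- **Euclidean space is not PIC1** (pair form): for the Euclidean metric of a finite-dimensional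
real inner product space `V` of dimension `≥ 4` and its natural flat connection `D`
(`ModelSpace.flatConnection V`), Brendle's expression vanishes identically, in particular on the
orthonormal 4-frame given by the first four standard basis vectors, so `(g, D)` is not PIC1.
[cite: ONeillSemiRiemannian1983, Ch. 3, remark after Prop. 3.41 (p. 80)] -/
theorem not_hasPIC1With_euclideanMetric_flatConnection (hV : 4 ≤ finrank ℝ V) :
    ¬ (euclideanMetric V).HasPIC1With (ModelSpace.flatConnection V) :=
  not_hasPIC1With_of_isFlat ModelSpace.isFlat_flatConnection
    (isOrthonormalFrame_euclideanMetric (orthonormal_stdOrthonormalBasis_comp_castLE hV) 0)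

variable [CompleteSpace V]

/-- **The natural connection is a Levi-Civita connection of the Euclidean metric** (O'Neill 1983,
Ch. 3, Lemma 3.14 for `ℝⁿ = ℝⁿ₀`): the components of `euclideanMetric V` are constant
(`euclideanMetric_val_eq_innerSL`). [cite: ONeillSemiRiemannian1983, Ch. 3, Lemma 3.14] -/
theorem isLeviCivita_flatConnection_euclideanMetric :
    (euclideanMetric V).IsLeviCivita (ModelSpace.flatConnection V) :=
  ModelSpace.isLeviCivita_flatConnection (euclideanMetric V) (innerSL ℝ (E := V))
    euclideanMetric_val_eq_innerSL

/-- **Euclidean space is not PIC1**: for a finite-dimensional real inner product space `V` of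
dimension `≥ 4`, the Euclidean metric `euclideanMetric V` (on the manifold `V` modelled on itself)
does **not** satisfy Brendle's condition (2) (`HasPIC1`): its natural connection is a flat
Levi-Civita connection (O'Neill 1983, Ch. 3, Lemma 3.14 and p. 80), so at the orthonormal 4-frame of
the first four standard basis vectors `R₁₃₁₃ + λ²R₁₄₁₄ + R₂₃₂₃ + λ²R₂₄₂₄ - 2λR₁₂₃₄ = 0 ≯ 0`. Condition
(2) is the *hypothesis* of Brendle 2008, Thm. 2 ("Assume that (2) holds … Then the normalized Ricci
flow … converges to a constant curvature metric"), not an assertion about all metrics; the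
definition `HasPIC1` therefore admits no `HasPIC1_holds`. [cite: Brendle2008, §1, Thm. 2, condition (2)]
[cite: ONeillSemiRiemannian1983, Ch. 3, Lemma 3.14 and remark after Prop. 3.41 (p. 80)] -/
theorem not_hasPIC1_euclideanMetric (hV : 4 ≤ finrank ℝ V) : ¬ (euclideanMetric V).HasPIC1 :=
  not_hasPIC1_of_isFlat isLeviCivita_flatConnection_euclideanMetric ModelSpace.isFlat_flatConnection
    (isOrthonormalFrame_euclideanMetric (orthonormal_stdOrthonormalBasis_comp_castLE hV) 0)

/-- **Euclidean space does not have positive isotropic curvature** (Micallef–Moore's condition,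
`HasPositiveIsotropicCurvature`, `IsotropicCurvature.lean`), `4 ≤ dim V < ∞`: the isotropic
curvature of the flat Levi-Civita connection vanishes on the orthonormal 4-frame of the first four
standard basis vectors (`not_hasPositiveIsotropicCurvature_of_isFlat`).
[cite: ONeillSemiRiemannian1983, Ch. 3, remark after Prop. 3.41 (p. 80)] -/
theorem not_hasPositiveIsotropicCurvature_euclideanMetric (hV : 4 ≤ finrank ℝ V) :
    ¬ (euclideanMetric V).HasPositiveIsotropicCurvature :=
  not_hasPositiveIsotropicCurvature_of_isFlat isLeviCivita_flatConnection_euclideanMetric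
    ModelSpace.isFlat_flatConnection
    (isOrthonormalFrame_euclideanMetric (orthonormal_stdOrthonormalBasis_comp_castLE hV) 0)

/-- **Euclidean space does not have positive curvature operator** (Hamilton's condition,
`HasPositiveCurvatureOperator`, `CurvatureOperator.lean`), `2 ≤ dim V < ∞`: `Rm ≡ 0` for the flat
Levi-Civita connection while the first two standard basis vectors span a nonzero 2-vector
(`not_hasPositiveCurvatureOperator_of_isFlat`). Hamilton 1986, p. 154 (flat `R⁴/Γ`).
[cite: ONeillSemiRiemannian1983, Ch. 3, remark after Prop. 3.41 (p. 80)] -/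
theorem not_hasPositiveCurvatureOperator_euclideanMetric (hV : 2 ≤ finrank ℝ V) :
    ¬ (euclideanMetric V).HasPositiveCurvatureOperator :=
  not_hasPositiveCurvatureOperator_of_isFlat isLeviCivita_flatConnection_euclideanMetric
    ModelSpace.isFlat_flatConnection
    (isOrthonormalFrame_euclideanMetric (orthonormal_stdOrthonormalBasis_comp_castLE hV) 0)

end EuclideanPIC1

/-- **Euclidean `ℝ⁴` is not PIC1**: the Euclidean metric of `EuclideanSpace ℝ (Fin 4)` violates
Brendle's condition (2). [cite: Brendle2008, §1, Thm. 2, condition (2)]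
[cite: ONeillSemiRiemannian1983, Ch. 3, remark after Prop. 3.41 (p. 80)] -/
theorem not_hasPIC1_euclideanSpace_four :
    ¬ (euclideanMetric (EuclideanSpace ℝ (Fin 4))).HasPIC1 :=
  not_hasPIC1_euclideanMetric (by rw [finrank_euclideanSpace_fin])

/-- **The definition `HasPIC1` is not a theorem**: its universal closure over the smooth
pseudo-Riemannian metrics of `ℝ⁴ = EuclideanSpace ℝ (Fin 4)` (modelled on itself) — the shape a
`HasPIC1_holds` would take there — is false, the Euclidean metric being a counterexample
(`not_hasPIC1_euclideanSpace_four`). PIC1 (Brendle 2008, Thm. 2, condition (2)) is a curvature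
*condition*, the hypothesis of that theorem. [cite: Brendle2008, §1, Thm. 2, condition (2)] -/
theorem not_forall_hasPIC1 :
    ¬ ∀ g : PseudoRiemannianMetric 𝓘(ℝ, EuclideanSpace ℝ (Fin 4)) ∞ (EuclideanSpace ℝ (Fin 4))
        (TangentSpace 𝓘(ℝ, EuclideanSpace ℝ (Fin 4)) : EuclideanSpace ℝ (Fin 4) → Type _),
      g.HasPIC1 :=
  fun h ↦ not_hasPIC1_euclideanSpace_four (h _)

/-- Euclidean `ℝ⁴` does not have positive isotropic curvature.
[cite: ONeillSemiRiemannian1983, Ch. 3, remark after Prop. 3.41 (p. 80)] -/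
theorem not_hasPositiveIsotropicCurvature_euclideanSpace_four :
    ¬ (euclideanMetric (EuclideanSpace ℝ (Fin 4))).HasPositiveIsotropicCurvature :=
  not_hasPositiveIsotropicCurvature_euclideanMetric (by rw [finrank_euclideanSpace_fin])

/-- Euclidean `ℝ⁴` does not have positive curvature operator (Hamilton 1986, p. 154: `R⁴` and its
flat quotients). [cite: ONeillSemiRiemannian1983, Ch. 3, remark after Prop. 3.41 (p. 80)] -/
theorem not_hasPositiveCurvatureOperator_euclideanSpace_four :
    ¬ (euclideanMetric (EuclideanSpace ℝ (Fin 4))).HasPositiveCurvatureOperator :=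
  not_hasPositiveCurvatureOperator_euclideanMetric (by simp)

end Literature.Geometry.Riemannian

end
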